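import Summits.CriticalPhenomena.PercolationContinuityZ3.Theorems.Transplant.GrigorchukPowerTraceMonotonicity
import Summits.CriticalPhenomena.PercolationContinuityZ3.Theorems.Transplant.AndoFejerTrace
import HarnessLib

/-!
# Hutchcroft's diagram comparison `B_p ≤ A_p` on vertex-transitive graphs of subexponential growth (Prop. 1.7, first inequality), by the finite
# Ando–Fejér trace inequality and the Følner sandwich — no von Neumann algebra, no Fourier analysis, no named fact

Definition + proof file (`--kind definition` because of the four diagram definitions; `--supports stmt-CriticalPhenomena-4575 --as helper`), lane `prim-bschramm`, seat
`prim-bschramm-gen-1` gen 12 (GEN pen); item (c) of lead g29's Q-DOOR-2 (#10006, #10021), the refuter's lemma E-p5g35-2 (#10003).  builds on p205010 (kernel theorem,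
internal audit signed; external expert review pending) — nothing here uses p205010.  No instance, no notation, no sorry; nothing about `θ(p_c)`; generic over a
connected, vertex-transitive, locally finite graph NOT of exponential growth (`Cay(𝔊^k; std)`, the lane's W1/W2, every amenable-by-growth Cayley graph).

THE DIAGRAMS (Hutchcroft 2022, (1.10)–(1.11), rooted at `v`, as `ℝ≥0∞`-valued sums over `V⁴`; `τ = τ_p`, `T²(a,b) = Σ_z τ(a,z)τ(z,b)`, `T³` likewise):
`diagA G v p = Σ_x τ(v,x) T²(v,x) T³(v,x) = Σ_{(x,z,u,w)} τ(v,x)·[τ(v,z)τ(z,x)]·[τ(v,u)τ(u,w)τ(w,x)]` and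
`diagB G v p = Σ_w T²(v,w)³ = Σ_{(w,z₁,z₂,z₃)} [τ(v,z₁)τ(z₁,w)][τ(v,z₂)τ(z₂,w)][τ(v,z₃)τ(z₃,w)]` (summands `summandA`, `summandB`).
THE THEOREM: **`diagB_le_diagA (htr : IsGraphTransitive G) (hconn : G.Connected) (hgr : ¬ HasExponentialGrowth G) (v) (p) : diagB G v p ≤ diagA G v p`** — for EVERY
`p` (if `A = ∞` there is nothing to prove).  PROOF: on the window `B = B_R(v)` with the PSD two-point matrix `T_B` (E4.3b `posSemidef_connMatrix`),
`|B_{R−S}(v)|·B^{(S)}(v) ≤ Σ_{x,y∈B} (T_B²)_{xy}³ ≤ Σ_{x,y∈B} (T_B)_{xy}(T_B³)_{xy}(T_B²)_{xy} ≤ |B_R(v)|·A(v)` (ball-local version `B^{(S)}` below, the finite Ando–Fejér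
inequality «AndoFejerTrace» in the middle, finite sums below the full diagram above, `Aut(G)`-invariance at both ends), then the Følner step of E4.3c
(`le_of_forall_mul_card_ball_le`: no exponential growth ⇒ `inf_R |B_R|/|B_{R−S}| = 1`) and `B = sup_S B^{(S)}`.
[cite: Hutchcroft2022Triangle, Prop. 1.7, (1.10)–(1.11), §3] [cite: HeydenreichVanDerHofstad2017, §4.1 (triangle condition; diagrams)]
-/

noncomputable section

namespace Summit.CriticalPhenomena.PercolationContinuityZ3.Theorems.Transplant

namespace Grigorchuk

namespace NcHaraSlade

open SimpleGraph Finset MeasureTheory Filter Literature.Probability.Percolation Literature.Barriers.CriticalPhenomena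
open scoped ENNReal

variable {V : Type} [DecidableEq V] (G : SimpleGraph V) [G.LocallyFinite]

/-! ## §1 The diagrams `A_p`, `B_p` rooted at a vertex -/

/-- The summand of `A_p` rooted at `v` at `q = (x, z, u, w)`: `τ(v,x)·[τ(v,z)τ(z,x)]·[τ(v,u)τ(u,w)τ(w,x)]`. [cite: Hutchcroft2022Triangle, (1.10)] -/
def summandA (G : SimpleGraph V) (p : unitInterval) (v : V) (q : V × V × V × V) : ℝ :=
  conn G p v q.1 * (conn G p v q.2.1 * conn G p q.2.1 q.1) * (conn G p v q.2.2.1 * conn G p q.2.2.1 q.2.2.2 * conn G p q.2.2.2 q.1)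

/-- The summand of `B_p` rooted at `v` at `q = (w, z₁, z₂, z₃)`: `[τ(v,z₁)τ(z₁,w)]·[τ(v,z₂)τ(z₂,w)]·[τ(v,z₃)τ(z₃,w)]`. [cite: Hutchcroft2022Triangle, (1.11)] -/
def summandB (G : SimpleGraph V) (p : unitInterval) (v : V) (q : V × V × V × V) : ℝ :=
  (conn G p v q.2.1 * conn G p q.2.1 q.1) * (conn G p v q.2.2.1 * conn G p q.2.2.1 q.1) * (conn G p v q.2.2.2 * conn G p q.2.2.2 q.1)

/-- **`A_p(v) = Σ_x τ(v,x) T²(v,x) T³(v,x) ∈ [0, ∞]`** (Hutchcroft's diagram `A`, rooted). [cite: Hutchcroft2022Triangle, (1.10)] -/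
def diagA (G : SimpleGraph V) (v : V) (p : unitInterval) : ℝ≥0∞ := ∑' q : V × V × V × V, ENNReal.ofReal (summandA G p v q)

/-- **`B_p(v) = Σ_w T²(v,w)³ ∈ [0, ∞]`** (Hutchcroft's diagram `B`, rooted). [cite: Hutchcroft2022Triangle, (1.11)] -/
def diagB (G : SimpleGraph V) (v : V) (p : unitInterval) : ℝ≥0∞ := ∑' q : V × V × V × V, ENNReal.ofReal (summandB G p v q)

omit [DecidableEq V] [G.LocallyFinite] in
/-- `summandA ≥ 0`. [folklore] -/
theorem summandA_nonneg (p : unitInterval) (v : V) (q : V × V × V × V) : 0 ≤ summandA G p v q := by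
  have h := conn_nonneg G p
  exact mul_nonneg (mul_nonneg (h _ _) (mul_nonneg (h _ _) (h _ _))) (mul_nonneg (mul_nonneg (h _ _) (h _ _)) (h _ _))

omit [DecidableEq V] [G.LocallyFinite] in
/-- `summandB ≥ 0`. [folklore] -/
theorem summandB_nonneg (p : unitInterval) (v : V) (q : V × V × V × V) : 0 ≤ summandB G p v q := by
  have h := conn_nonneg G p
  exact mul_nonneg (mul_nonneg (mul_nonneg (h _ _) (h _ _)) (mul_nonneg (h _ _) (h _ _))) (mul_nonneg (h _ _) (h _ _))

/-! ## §2 Automorphism invariance -/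

omit [DecidableEq V] [G.LocallyFinite] in
/-- `summandA` is `Aut(G)`-invariant. [folklore] -/
theorem summandA_iso (γ : G ≃g G) (p : unitInterval) (v : V) (q : V × V × V × V) :
    summandA G p (γ v) (γ q.1, γ q.2.1, γ q.2.2.1, γ q.2.2.2) = summandA G p v q := by
  simp only [summandA, conn_iso]

omit [DecidableEq V] [G.LocallyFinite] in
/-- `summandB` is `Aut(G)`-invariant. [folklore] -/
theorem summandB_iso (γ : G ≃g G) (p : unitInterval) (v : V) (q : V × V × V × V) :
    summandB G p (γ v) (γ q.1, γ q.2.1, γ q.2.2.1, γ q.2.2.2) = summandB G p v q := by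
  simp only [summandB, conn_iso]

omit [DecidableEq V] [G.LocallyFinite] in
/-- **`A_p(γ v) = A_p(v)`**. [folklore] -/
theorem diagA_iso (γ : G ≃g G) (v : V) (p : unitInterval) : diagA G (γ v) p = diagA G v p := by
  unfold diagA
  set e : V × V × V × V ≃ V × V × V × V := Equiv.prodCongr γ.toEquiv (Equiv.prodCongr γ.toEquiv (Equiv.prodCongr γ.toEquiv γ.toEquiv)) with he
  rw [← e.tsum_eq]
  refine tsum_congr fun q => ?_
  have hq : e q = (γ q.1, γ q.2.1, γ q.2.2.1, γ q.2.2.2) := by simp only [he, Equiv.prodCongr_apply, Prod.map, RelIso.coe_fn_toEquiv]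
  rw [hq, summandA_iso]

/-- The ball-restricted diagram `B^{(S)}(x) = Σ_{q ∈ B_S(x)⁴} summandB(x, q)` is `Aut(G)`-invariant. [folklore] -/
theorem locDiagB_iso (γ : G ≃g G) (p : unitInterval) (x : V) (S : ℕ) :
    ∑ q ∈ DCTQ.ball G (γ x) S ×ˢ (DCTQ.ball G (γ x) S ×ˢ (DCTQ.ball G (γ x) S ×ˢ DCTQ.ball G (γ x) S)), summandB G p (γ x) q =
      ∑ q ∈ DCTQ.ball G x S ×ˢ (DCTQ.ball G x S ×ˢ (DCTQ.ball G x S ×ˢ DCTQ.ball G x S)), summandB G p x q := by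
  symm
  refine Finset.sum_equiv (Equiv.prodCongr γ.toEquiv (Equiv.prodCongr γ.toEquiv (Equiv.prodCongr γ.toEquiv γ.toEquiv))) (fun q => ?_) (fun q _ => ?_)
  · simp only [Finset.mem_product, Equiv.prodCongr_apply, Prod.map, RelIso.coe_fn_toEquiv, DCTQ.apply_mem_ball_iff]
  · simp only [Equiv.prodCongr_apply, Prod.map, RelIso.coe_fn_toEquiv]
    exact (summandB_iso G γ p x q).symm

/-! ## §3 `B_p` is the supremum of its ball restrictions -/

/-- **`B_p(v) ≤ b` as soon as every ball restriction satisfies `ofReal B^{(S)}(v) ≤ b`** (connected graph: each finite set of quadruples sits in some `B_S(v)⁴`).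
[cite: Hutchcroft2022Triangle, (1.11)] -/
theorem diagB_le_of_forall_ball (hconn : G.Connected) (v : V) (p : unitInterval) {b : ℝ≥0∞}
    (h : ∀ S : ℕ, ENNReal.ofReal (∑ q ∈ DCTQ.ball G v S ×ˢ (DCTQ.ball G v S ×ˢ (DCTQ.ball G v S ×ˢ DCTQ.ball G v S)), summandB G p v q) ≤ b) :
    diagB G v p ≤ b := by
  unfold diagB
  rw [ENNReal.tsum_eq_iSup_sum]
  refine iSup_le fun F => ?_
  obtain ⟨S, hS⟩ := DCTQ.exists_subset_ball hconn v
    (F.image (fun q => q.1) ∪ F.image (fun q => q.2.1) ∪ F.image (fun q => q.2.2.1) ∪ F.image (fun q => q.2.2.2))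
  have hF : F ⊆ DCTQ.ball G v S ×ˢ (DCTQ.ball G v S ×ˢ (DCTQ.ball G v S ×ˢ DCTQ.ball G v S)) := by
    intro q hq
    simp only [Finset.mem_product]
    refine ⟨hS ?_, hS ?_, hS ?_, hS ?_⟩
    · exact Finset.mem_union_left _ (Finset.mem_union_left _ (Finset.mem_union_left _ (Finset.mem_image_of_mem _ hq)))
    · exact Finset.mem_union_left _ (Finset.mem_union_left _ (Finset.mem_union_right _ (Finset.mem_image_of_mem _ hq)))
    · exact Finset.mem_union_left _ (Finset.mem_union_right _ (Finset.mem_image_of_mem _ hq))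
    · exact Finset.mem_union_right _ (Finset.mem_image_of_mem _ hq)
  calc ∑ q ∈ F, ENNReal.ofReal (summandB G p v q)
      ≤ ∑ q ∈ DCTQ.ball G v S ×ˢ (DCTQ.ball G v S ×ˢ (DCTQ.ball G v S ×ˢ DCTQ.ball G v S)), ENNReal.ofReal (summandB G p v q) :=
        Finset.sum_le_sum_of_subset hF
    _ = ENNReal.ofReal (∑ q ∈ DCTQ.ball G v S ×ˢ (DCTQ.ball G v S ×ˢ (DCTQ.ball G v S ×ˢ DCTQ.ball G v S)), summandB G p v q) :=
        (ENNReal.ofReal_sum_of_nonneg fun q _ => summandB_nonneg G p v q).symm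
    _ ≤ b := h S

omit [DecidableEq V] [G.LocallyFinite] in
/-- Finite partial sums of `A_p(x)` are below `A_p(x)` (as a real number, when `A_p(x) < ∞`). [folklore] -/
theorem sum_summandA_le_toReal (p : unitInterval) (x : V) (F : Finset (V × V × V × V)) (hfin : diagA G x p ≠ ⊤) :
    ∑ q ∈ F, summandA G p x q ≤ (diagA G x p).toReal := by
  rw [← ENNReal.ofReal_le_iff_le_toReal hfin, ENNReal.ofReal_sum_of_nonneg fun q _ => summandA_nonneg G p x q]
  exact ENNReal.sum_le_tsum F

/-! ## §4 The finite window: the two-point matrix `T_B` on `B = B_R(v)` -/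

omit [G.LocallyFinite] in
/-- `(T_B²)(x, y) = Σ_{z∈B} τ(x,z) τ(z,y)`. [folklore] -/
theorem connMatrix_sq_apply (p : unitInterval) (B : Finset V) (x y : ↥B) :
    ((Matrix.of fun a b : ↥B => conn G p (a : V) (b : V)) ^ 2) x y = ∑ z ∈ B, conn G p (x : V) z * conn G p z (y : V) := by
  rw [pow_two, Matrix.mul_apply]
  simp only [Matrix.of_apply]
  exact Finset.sum_coe_sort B (fun z => conn G p (x : V) z * conn G p z (y : V))

omit [G.LocallyFinite] in
/-- `(T_B³)(x, y) = Σ_{u,w∈B} τ(x,u) τ(u,w) τ(w,y)`. [folklore] -/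
theorem connMatrix_cube_apply (p : unitInterval) (B : Finset V) (x y : ↥B) :
    ((Matrix.of fun a b : ↥B => conn G p (a : V) (b : V)) ^ 3) x y = ∑ u ∈ B, ∑ w ∈ B, conn G p (x : V) u * conn G p u w * conn G p w (y : V) := by
  rw [pow_succ, pow_two, Matrix.mul_apply]
  simp only [Matrix.mul_apply, Matrix.of_apply, Finset.sum_mul]
  rw [Finset.sum_comm]
  have h1 : ∀ u : V, ∑ w : ↥B, conn G p (x : V) u * conn G p u (w : V) * conn G p (w : V) (y : V) =
      ∑ w ∈ B, conn G p (x : V) u * conn G p u w * conn G p w (y : V) :=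
    fun u => Finset.sum_coe_sort B (fun w => conn G p (x : V) u * conn G p u w * conn G p w (y : V))
  simp only [h1]
  exact Finset.sum_coe_sort B (fun u => ∑ w ∈ B, conn G p (x : V) u * conn G p u w * conn G p w (y : V))

omit [DecidableEq V] [G.LocallyFinite] in
/-- `(Σ_{z∈s} f z)³ = Σ_{z₁,z₂,z₃∈s} f z₁ f z₂ f z₃`. [folklore] -/
theorem sum_pow_three_eq {ι : Type} (s : Finset ι) (f : ι → ℝ) :
    (∑ z ∈ s, f z) ^ 3 = ∑ z₁ ∈ s, ∑ z₂ ∈ s, ∑ z₃ ∈ s, f z₁ * f z₂ * f z₃ := by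
  rw [pow_succ, pow_two, Finset.sum_mul_sum, Finset.sum_mul]
  refine Finset.sum_congr rfl fun z₁ _ => ?_
  rw [Finset.sum_mul]
  refine Finset.sum_congr rfl fun z₂ _ => ?_
  rw [Finset.mul_sum]

omit [G.LocallyFinite] in
/-- **The `B`-side identity on a window**: `Σ_{y∈B} (T_B²)(x,y)³ = Σ_{q∈B⁴} summandB(x, q)`. [cite: Hutchcroft2022Triangle, (1.11)] -/
theorem sum_connMatrix_sq_cube_eq (p : unitInterval) (B : Finset V) (x : ↥B) :
    ∑ y : ↥B, ((Matrix.of fun a b : ↥B => conn G p (a : V) (b : V)) ^ 2) x y ^ 3 = ∑ q ∈ B ×ˢ (B ×ˢ (B ×ˢ B)), summandB G p (x : V) q := by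
  simp only [connMatrix_sq_apply, sum_pow_three_eq, Finset.sum_product, summandB]
  exact Finset.sum_coe_sort B (fun w => ∑ z₁ ∈ B, ∑ z₂ ∈ B, ∑ z₃ ∈ B,
    conn G p (x : V) z₁ * conn G p z₁ w * (conn G p (x : V) z₂ * conn G p z₂ w) * (conn G p (x : V) z₃ * conn G p z₃ w))

omit [G.LocallyFinite] in
/-- **The `A`-side identity on a window**: `Σ_{y∈B} (T_B)(x,y)(T_B³)(x,y)(T_B²)(x,y) = Σ_{q∈B⁴} summandA(x, q)`. [cite: Hutchcroft2022Triangle, (1.10)] -/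
theorem sum_connMatrix_one_three_two_eq (p : unitInterval) (B : Finset V) (x : ↥B) :
    ∑ y : ↥B, (Matrix.of fun a b : ↥B => conn G p (a : V) (b : V)) x y *
        ((Matrix.of fun a b : ↥B => conn G p (a : V) (b : V)) ^ 3) x y * ((Matrix.of fun a b : ↥B => conn G p (a : V) (b : V)) ^ 2) x y =
      ∑ q ∈ B ×ˢ (B ×ˢ (B ×ˢ B)), summandA G p (x : V) q := by
  simp only [connMatrix_sq_apply, connMatrix_cube_apply, Matrix.of_apply, Finset.sum_product, summandA]
  -- `Σ_y τ(x,y)·(Σ_u Σ_w …)·(Σ_z …) = Σ_y Σ_z Σ_u Σ_w τ(x,y)·[τ(x,z)τ(z,y)]·[τ(x,u)τ(u,w)τ(w,y)]`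
  have h : ∀ y : V, conn G p (x : V) y * (∑ u ∈ B, ∑ w ∈ B, conn G p (x : V) u * conn G p u w * conn G p w y) * (∑ z ∈ B, conn G p (x : V) z * conn G p z y) =
      ∑ z ∈ B, ∑ u ∈ B, ∑ w ∈ B, conn G p (x : V) y * (conn G p (x : V) z * conn G p z y) * (conn G p (x : V) u * conn G p u w * conn G p w y) := by
    intro y
    rw [mul_comm, ← mul_assoc, Finset.sum_mul, Finset.sum_mul]
    refine Finset.sum_congr rfl fun z _ => ?_
    rw [Finset.mul_sum]
    refine Finset.sum_congr rfl fun u _ => ?_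
    rw [Finset.mul_sum]
    exact Finset.sum_congr rfl fun w _ => by ring
  simp only [h]
  exact Finset.sum_coe_sort B (fun y => ∑ z ∈ B, ∑ u ∈ B, ∑ w ∈ B,
    conn G p (x : V) y * (conn G p (x : V) z * conn G p z y) * (conn G p (x : V) u * conn G p u w * conn G p w y))

/-! ## §5 `B_p ≤ A_p` -/

/-- **The per-radius inequality**: `B^{(S)}(v) · |B_{R−S}(v)| ≤ A_p(v) · |B_R(v)|` for `S ≤ R`, on a connected transitive graph with `A_p(v) < ∞` — the finite
Ando–Fejér inequality on the window `B_R(v)` between the ball-local `B`-diagram (below) and the full `A`-diagram (above). [cite: Hutchcroft2022Triangle, Prop. 1.7] -/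
theorem locDiagB_mul_card_le [Countable V] (htr : IsGraphTransitive G) {p : unitInterval} {v : V} (hfin : diagA G v p ≠ ⊤) {S R : ℕ} (hSR : S ≤ R) :
    (∑ q ∈ DCTQ.ball G v S ×ˢ (DCTQ.ball G v S ×ˢ (DCTQ.ball G v S ×ˢ DCTQ.ball G v S)), summandB G p v q) * ((DCTQ.ball G v (R - S)).card : ℝ) ≤
      (diagA G v p).toReal * ((DCTQ.ball G v R).card : ℝ) := by
  set B : Finset V := DCTQ.ball G v R with hB
  set P : Matrix ↥B ↥B ℝ := Matrix.of fun a b : ↥B => conn G p (a : V) (b : V) with hP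
  have hPsd : P.PosSemidef := posSemidef_connMatrix G p B
  have hAx : ∀ x : V, diagA G x p = diagA G v p := fun x => by
    obtain ⟨γ, hγ⟩ := htr v x
    rw [← hγ, diagA_iso]
  -- the window sums of `summandB` / `summandA` at a root `x ∈ B`
  set gB : V → ℝ := fun x => ∑ q ∈ B ×ˢ (B ×ˢ (B ×ˢ B)), summandB G p x q with hgB
  set gA : V → ℝ := fun x => ∑ q ∈ B ×ˢ (B ×ˢ (B ×ˢ B)), summandA G p x q with hgA
  -- (1) `B^{(S)}(v)·|B_{R−S}| = Σ_{x∈B_{R−S}} B^{(S)}(x)`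
  have h1 : (∑ q ∈ DCTQ.ball G v S ×ˢ (DCTQ.ball G v S ×ˢ (DCTQ.ball G v S ×ˢ DCTQ.ball G v S)), summandB G p v q) * ((DCTQ.ball G v (R - S)).card : ℝ) =
      ∑ x ∈ DCTQ.ball G v (R - S), ∑ q ∈ DCTQ.ball G x S ×ˢ (DCTQ.ball G x S ×ˢ (DCTQ.ball G x S ×ˢ DCTQ.ball G x S)), summandB G p x q := by
    rw [mul_comm, ← nsmul_eq_mul, ← Finset.sum_const]
    refine Finset.sum_congr rfl fun x _ => ?_
    obtain ⟨γ, hγ⟩ := htr v x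
    rw [← hγ, locDiagB_iso]
  -- (2) `B^{(S)}(x) ≤ gB x` for `x ∈ B_{R−S}(v)` (`B_S(x) ⊆ B`)
  have h2 : ∀ x ∈ DCTQ.ball G v (R - S),
      ∑ q ∈ DCTQ.ball G x S ×ˢ (DCTQ.ball G x S ×ˢ (DCTQ.ball G x S ×ˢ DCTQ.ball G x S)), summandB G p x q ≤ gB x := by
    intro x hx
    have hsub : DCTQ.ball G x S ⊆ B := fun y hy => by
      have hy' := DCTQ.mem_ball_add hx hy
      rwa [Nat.sub_add_cancel hSR] at hy'
    exact Finset.sum_le_sum_of_subset_of_nonneg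
      (Finset.product_subset_product hsub (Finset.product_subset_product hsub (Finset.product_subset_product hsub hsub)))
      fun q _ _ => summandB_nonneg G p x q
  -- (3) `Σ_{x∈B_{R−S}} gB x ≤ Σ_{x∈B} gB x = Σ_{x,y∈B} (T_B²)³`
  have h3 : ∑ x ∈ DCTQ.ball G v (R - S), gB x ≤ ∑ x ∈ B, gB x :=
    Finset.sum_le_sum_of_subset_of_nonneg (DCTQ.ball_mono v (Nat.sub_le R S)) fun x _ _ => Finset.sum_nonneg fun q _ => summandB_nonneg G p x q
  have h4 : ∑ x ∈ B, gB x = ∑ x : ↥B, ∑ y : ↥B, (P ^ 2) x y ^ 3 := by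
    rw [← Finset.sum_coe_sort B]
    exact Finset.sum_congr rfl fun x _ => (sum_connMatrix_sq_cube_eq G p B x).symm
  -- (4) Ando–Fejér on the window
  have h5 : ∑ x : ↥B, ∑ y : ↥B, (P ^ 2) x y ^ 3 ≤ ∑ x : ↥B, ∑ y : ↥B, P x y * (P ^ 3) x y * (P ^ 2) x y :=
    TraceShadow.sum_pow_two_cube_le P hPsd
  -- (5) `Σ_{x,y∈B} T_B T_B³ T_B² = Σ_{x∈B} gA x ≤ |B| · A(v)`
  have h6 : ∑ x : ↥B, ∑ y : ↥B, P x y * (P ^ 3) x y * (P ^ 2) x y = ∑ x ∈ B, gA x := by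
    rw [← Finset.sum_coe_sort B]
    exact Finset.sum_congr rfl fun x _ => sum_connMatrix_one_three_two_eq G p B x
  have h7 : ∑ x ∈ B, gA x ≤ ((DCTQ.ball G v R).card : ℝ) * (diagA G v p).toReal := by
    calc ∑ x ∈ B, gA x ≤ ∑ _x ∈ B, (diagA G v p).toReal :=
          Finset.sum_le_sum fun x _ => by rw [← hAx x]; exact sum_summandA_le_toReal G p x _ (by rw [hAx]; exact hfin)
      _ = ((DCTQ.ball G v R).card : ℝ) * (diagA G v p).toReal := by rw [Finset.sum_const, nsmul_eq_mul]
  calc (∑ q ∈ DCTQ.ball G v S ×ˢ (DCTQ.ball G v S ×ˢ (DCTQ.ball G v S ×ˢ DCTQ.ball G v S)), summandB G p v q) * ((DCTQ.ball G v (R - S)).card : ℝ)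
      = ∑ x ∈ DCTQ.ball G v (R - S), ∑ q ∈ DCTQ.ball G x S ×ˢ (DCTQ.ball G x S ×ˢ (DCTQ.ball G x S ×ˢ DCTQ.ball G x S)), summandB G p x q := h1
    _ ≤ ∑ x ∈ DCTQ.ball G v (R - S), gB x := Finset.sum_le_sum h2
    _ ≤ ∑ x ∈ B, gB x := h3
    _ = ∑ x : ↥B, ∑ y : ↥B, (P ^ 2) x y ^ 3 := h4
    _ ≤ ∑ x : ↥B, ∑ y : ↥B, P x y * (P ^ 3) x y * (P ^ 2) x y := h5
    _ = ∑ x ∈ B, gA x := h6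
    _ ≤ ((DCTQ.ball G v R).card : ℝ) * (diagA G v p).toReal := h7
    _ = (diagA G v p).toReal * ((DCTQ.ball G v R).card : ℝ) := mul_comm _ _

/-- **Hutchcroft's `B_p ≤ A_p` on vertex-transitive graphs of subexponential growth** (Prop. 1.7, first inequality), for EVERY `p ∈ [0,1]`: connected, vertex-transitive,
locally finite, NOT of exponential growth ⇒ `diagB G v p ≤ diagA G v p`.  (Finite Ando–Fejér inequality on growing balls + the Følner step of E4.3c; hypotheses =
`Cay(𝔊^k; std)`'s standing.) [cite: Hutchcroft2022Triangle, Prop. 1.7] -/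
theorem diagB_le_diagA (htr : IsGraphTransitive G) (hconn : G.Connected) (hgr : ¬ HasExponentialGrowth G) (v : V) (p : unitInterval) :
    diagB G v p ≤ diagA G v p := by
  haveI : Countable V := countable_of_connected_of_locallyFinite G hconn v
  by_cases hfin : diagA G v p = ⊤
  · rw [hfin]; exact le_top
  refine diagB_le_of_forall_ball G hconn v p fun S => ?_
  have hle : ∑ q ∈ DCTQ.ball G v S ×ˢ (DCTQ.ball G v S ×ˢ (DCTQ.ball G v S ×ˢ DCTQ.ball G v S)), summandB G p v q ≤ (diagA G v p).toReal :=
    le_of_forall_mul_card_ball_le G htr hgr v S ENNReal.toReal_nonneg fun R hSR => locDiagB_mul_card_le G htr hfin hSR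
  calc ENNReal.ofReal (∑ q ∈ DCTQ.ball G v S ×ˢ (DCTQ.ball G v S ×ˢ (DCTQ.ball G v S ×ˢ DCTQ.ball G v S)), summandB G p v q)
      ≤ ENNReal.ofReal ((diagA G v p).toReal) := ENNReal.ofReal_le_ofReal hle
    _ = diagA G v p := ENNReal.ofReal_toReal hfin

end NcHaraSlade

end Grigorchuk

end Summit.CriticalPhenomena.PercolationContinuityZ3.Theorems.Transplant

end
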